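import Literature.InformationTheory.QuantumCodes.RefinedLPBoundEvenSubcode
import HarnessLib

/-!
# Subgroup orders and quadratic parity counts inside the refined weight distribution (constraints beyond the LP)

Venture QEC (cell `qec`, LADDER-QEC rung X1; row 06). OUR side of the refined LP machinery: two classical sources of
constraints on an additive code that are NOT linear-programming constraints but become visible in the refined weight
distribution `refDist C u₀ (a,b,c)` of [CalderbankEtAl1998, §7 (ii)] (`a` = weight off the support of `u₀`, `b` =
agreements with `u₀`, `c` = other nonzero letters on the support):

1. **Subgroup orders are powers of two.** The vectors whose letters on `supp u₀` lie in `{0, (u₀)ᵢ}` form an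
   `𝔽₂`-subspace `sameOrZeroSub u₀` of `Ē` (membership ⇔ `c(v) = 0`), and so do the vectors vanishing off `supp u₀`
   (`onSuppSub u₀`, membership ⇔ `a(v) = 0`); hence `#{v ∈ C : c(v) = 0}` and `#{v ∈ C : a(v) = 0 ∧ c(v) = 0}` are powers
   of two for every additive `C` (orders of the subgroups `C ∩ V`). This is the elementary principle behind the
   «additional constraints on the size of Pauli subgroups» of [LaiAshikhmin2018, §5.1 and Cor. 22 of the stabilizer
   case: `Σ_{j even} A_j^⊥ = 2^{n−k−1}(4^k ± 2^k)`].
2. **Quadratic parity counts.** `v ↦ a(v) mod 2` is a quadratic function on `Ē` whose polarization is the symplectic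
   form restricted to the coordinates off `supp u₀` (CRSS eq. (7) `wt(u+v) ≡ wt u + wt v + u ∗ v`, read on a subset of
   the coordinates: `natCast_offWt_add`). For a quadratic function `q` on an `𝔽₂`-space `C` the character sum
   `s = Σ_{v ∈ C} (−1)^{q(v)}` satisfies `s² = |C| · Σ_{w ∈ rad} (−1)^{q(w)} ∈ {0, |C|·|rad|}` (`rad` the radical of
   the polarization inside `C`), so the number `Z` of zeros of `q` on `C` obeys `(2Z − |C|)² ∈ {0} ∪ {2^j}` — the
   counting half of Dickson's theorem on quadratic forms over `GF(2)` [MacWilliamsSloane1977, Ch. 15 §2, Thms. 4–5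
   (number of vectors with `Q(x) = 0`)]. Here: `offWt_parity_count`.

Everything is PROVED for every subspace `S̄ ≤ Ē` and every reference vector `u₀` (no hypothesis on `u₀`). Deliberately
NOT here: the linear system that USES these facts (`RefinedLPBoundQuadratic.lean`) and its certificates
(`RefinedQuadCertificate.lean`). HONEST FRAMING: necessary conditions for existence; nothing here certifies a distance. References:
[CalderbankEtAl1998] IEEE Trans. Inform. Theory 44 (1998) 1369–1387, §3 eq. (7), §7 (ii); [MacWilliamsSloane1977]
*The Theory of Error-Correcting Codes*, Ch. 15 §2; [LaiAshikhmin2018] C.-Y. Lai, A. Ashikhmin, IEEE Trans. Inform.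
Theory 64 (2018) 622–639 = arXiv:1602.00413, §5.1.
-/

namespace Summit.Ventures.QEC.Census

open Finset Literature.InformationTheory.QuantumCodes

variable {n : ℕ}

/-- `letters (v + u) i = letters v i + letters u i`. [folklore] -/
private theorem letters_add' (v u : SympVec n) (i : Fin n) : letters n (v + u) i = letters n v i + letters n u i := rfl

/-- `letters (c • v) i = c • letters v i`. [folklore] -/
private theorem letters_smul' (c : ZMod 2) (v : SympVec n) (i : Fin n) : letters n (c • v) i = c • letters n v i := rfl

/-! ### 1. Two coordinate subspaces visible in the refined classes -/

/-- The one-letter fact: `{0, r}` is closed under addition in `𝔽₂²`. [folklore] -/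
private theorem letter_mem_pair_add {r x y : ZMod 2 × ZMod 2} (hx : x = 0 ∨ x = r) (hy : y = 0 ∨ y = r) :
    x + y = 0 ∨ x + y = r := by
  rcases hx with rfl | rfl <;> rcases hy with rfl | rfl
  · left; simp
  · right; simp
  · right; simp
  · left; ext <;> exact CharTwo.add_self_eq_zero _

/-- **`V_{c=0}(u₀)`**: the vectors whose letter at every coordinate of `supp u₀` is `0` or the letter of `u₀` — an
`𝔽₂`-subspace of `Ē`. [folklore; cf. LaiAshikhmin2018, §5.1 (Pauli subgroups)] -/
def sameOrZeroSub (u₀ : SympVec n) : Submodule (ZMod 2) (SympVec n) where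
  carrier := {v | ∀ i, letters n u₀ i ≠ 0 → letters n v i = 0 ∨ letters n v i = letters n u₀ i}
  add_mem' := by
    intro v w hv hw i hi
    rw [letters_add']
    exact letter_mem_pair_add (hv i hi) (hw i hi)
  zero_mem' := by intro i _; left; rfl
  smul_mem' := by
    intro c v hv i hi
    rcases (by decide : ∀ t : ZMod 2, t = 0 ∨ t = 1) c with rfl | rfl
    · left; rw [zero_smul]; rfl
    · rw [one_smul]; exact hv i hi

/-- Membership in `V_{c=0}(u₀)` is `c(v) = 0`. [cite: CalderbankEtAl1998, §7 (ii) (printed p. 28, the class c)] -/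
theorem mem_sameOrZeroSub_iff {u₀ v : SympVec n} : v ∈ sameOrZeroSub u₀ ↔ otherCnt u₀ v = 0 := by
  unfold otherCnt
  rw [Finset.card_eq_zero, Finset.filter_eq_empty_iff]
  constructor
  · intro hv i _ ⟨hi, hv0, hne⟩
    rcases hv i hi with h | h
    · exact hv0 h
    · exact hne h
  · intro h i hi
    by_contra hcon
    push Not at hcon
    exact h (mem_univ i) ⟨hi, hcon.1, hcon.2⟩

/-- **`V_{a=0}(u₀)`**: the vectors vanishing off `supp u₀` — an `𝔽₂`-subspace of `Ē`. [folklore] -/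
def onSuppSub (u₀ : SympVec n) : Submodule (ZMod 2) (SympVec n) where
  carrier := {v | ∀ i, letters n u₀ i = 0 → letters n v i = 0}
  add_mem' := by
    intro v w hv hw i hi
    rw [letters_add', hv i hi, hw i hi, add_zero]
  zero_mem' := by intro i _; rfl
  smul_mem' := by
    intro c v hv i hi
    rw [letters_smul', hv i hi, smul_zero]

/-- Membership in `V_{a=0}(u₀)` is `a(v) = 0`. [cite: CalderbankEtAl1998, §7 (ii) (printed p. 28, the class a)] -/
theorem mem_onSuppSub_iff {u₀ v : SympVec n} : v ∈ onSuppSub u₀ ↔ offWt u₀ v = 0 := by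
  unfold offWt
  rw [Finset.card_eq_zero, Finset.filter_eq_empty_iff]
  constructor
  · intro hv i _ ⟨hi, hv0⟩; exact hv0 (hv i hi)
  · intro h i hi
    by_contra hcon
    exact h (mem_univ i) ⟨hi, hcon⟩

open scoped Classical in
/-- **The order of `C ∩ V_{c=0}(u₀)` is a power of two**: `#{v ∈ C : c(v) = 0} = 2^j`.
[folklore; cf. LaiAshikhmin2018, §5.1] -/
theorem card_filter_otherCnt_eq_zero_pow (S : Submodule (ZMod 2) (SympVec n)) (u₀ : SympVec n) :
    ∃ j : ℕ, #((codeWords S).filter fun v => otherCnt u₀ v = 0) = 2 ^ j := by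
  refine ⟨Module.finrank (ZMod 2) ↥(S ⊓ sameOrZeroSub u₀), ?_⟩
  rw [← card_codeWords (S ⊓ sameOrZeroSub u₀)]
  congr 1
  ext v
  simp only [mem_filter, mem_codeWords, Submodule.mem_inf, mem_sameOrZeroSub_iff]

open scoped Classical in
/-- **The order of `C ∩ V_{a=0}(u₀) ∩ V_{c=0}(u₀)` is a power of two**: `#{v ∈ C : a(v) = 0 ∧ c(v) = 0} = 2^j`.
[folklore; cf. LaiAshikhmin2018, §5.1] -/
theorem card_filter_offWt_otherCnt_eq_zero_pow (S : Submodule (ZMod 2) (SympVec n)) (u₀ : SympVec n) :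
    ∃ j : ℕ, #((codeWords S).filter fun v => offWt u₀ v = 0 ∧ otherCnt u₀ v = 0) = 2 ^ j := by
  refine ⟨Module.finrank (ZMod 2) ↥(S ⊓ (onSuppSub u₀ ⊓ sameOrZeroSub u₀)), ?_⟩
  rw [← card_codeWords (S ⊓ (onSuppSub u₀ ⊓ sameOrZeroSub u₀))]
  congr 1
  ext v
  simp only [mem_filter, mem_codeWords, Submodule.mem_inf, mem_sameOrZeroSub_iff, mem_onSuppSub_iff]

/-! ### 2. The off-support weight is quadratic: CRSS eq. (7) on a subset of the coordinates -/

/-- The symplectic form RESTRICTED to the coordinates off `supp u₀`: `(v,w)_T = Σ_{i : (u₀)ᵢ = 0} (vᵢ, wᵢ)`.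
[cite: CalderbankEtAl1998, §2 eq. (1) and §3 eq. (7) (printed pp. 4, 12)] -/
def sympInnerOff (u₀ v w : SympVec n) : ZMod 2 :=
  ∑ i, if letters n u₀ i = 0 then locInner (letters n v i) (letters n w i) else 0

/-- `(v,w)_T` is additive in `v`. [folklore] -/
theorem sympInnerOff_add_left (u₀ v v' w : SympVec n) :
    sympInnerOff u₀ (v + v') w = sympInnerOff u₀ v w + sympInnerOff u₀ v' w := by
  unfold sympInnerOff
  rw [← Finset.sum_add_distrib]
  refine Finset.sum_congr rfl fun i _ => ?_
  split_ifs
  · rw [letters_add']; unfold locInner; simp only [Prod.fst_add, Prod.snd_add]; ring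
  · simp

/-- `(v,w)_T` is symmetric. [folklore] -/
theorem sympInnerOff_comm (u₀ v w : SympVec n) : sympInnerOff u₀ v w = sympInnerOff u₀ w v := by
  unfold sympInnerOff
  refine Finset.sum_congr rfl fun i _ => ?_
  split_ifs
  · unfold locInner; ring
  · rfl

/-- `(v,w)_T` is additive in `w`. [folklore] -/
theorem sympInnerOff_add_right (u₀ v w w' : SympVec n) :
    sympInnerOff u₀ v (w + w') = sympInnerOff u₀ v w + sympInnerOff u₀ v w' := by
  rw [sympInnerOff_comm, sympInnerOff_add_left, sympInnerOff_comm u₀ w, sympInnerOff_comm u₀ w']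

/-- `a(v) = Σ_{i : (u₀)ᵢ = 0} wt(vᵢ)` (the off-support weight as a sum of one-letter weights).
[cite: CalderbankEtAl1998, §7 (ii) (printed p. 28)] -/
theorem offWt_eq_sum_locWt (u₀ v : SympVec n) :
    offWt u₀ v = ∑ i, if letters n u₀ i = 0 then locWt (letters n v i) else 0 := by
  unfold offWt locWt
  rw [Finset.card_filter]
  refine Finset.sum_congr rfl fun i _ => ?_
  by_cases h0 : letters n u₀ i = 0
  · by_cases hv : letters n v i = 0
    · rw [if_neg (fun h => h.2 hv), if_pos h0, if_pos hv]
    · rw [if_pos ⟨h0, hv⟩, if_pos h0, if_neg hv]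
  · rw [if_neg (fun h => h0 h.1), if_neg h0]

/-- **`a(v + w) ≡ a(v) + a(w) + (v,w)_T (mod 2)`** — CRSS eq. (7) summed over the coordinates off `supp u₀` only: the
off-support weight parity is a quadratic function with polarization `(·,·)_T`.
[cite: CalderbankEtAl1998, §3 eq. (7) (printed p. 12)] -/
theorem natCast_offWt_add (u₀ v w : SympVec n) :
    ((offWt u₀ (v + w) : ℕ) : ZMod 2) = offWt u₀ v + offWt u₀ w + sympInnerOff u₀ v w := by
  rw [offWt_eq_sum_locWt, offWt_eq_sum_locWt u₀ v, offWt_eq_sum_locWt u₀ w, sympInnerOff]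
  push_cast
  rw [← Finset.sum_add_distrib, ← Finset.sum_add_distrib]
  have h : ∀ a b : ZMod 2 × ZMod 2,
      ((locWt (a + b) : ℕ) : ZMod 2) = (locWt a : ZMod 2) + (locWt b : ZMod 2) + locInner a b := by
    unfold locWt locInner
    decide
  refine Finset.sum_congr rfl fun i _ => ?_
  by_cases h0 : letters n u₀ i = 0
  · rw [if_pos h0, if_pos h0, if_pos h0, if_pos h0, letters_add']
    exact h _ _
  · rw [if_neg h0, if_neg h0, if_neg h0, if_neg h0]; simp

/-! ### 3. Character sums of `𝔽₂`-valued additive functions -/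

/-- `χ(x + y) = χ(x) χ(y)` for `χ = (−1)^·` on `𝔽₂`. [folklore] -/
private theorem z2Sign_add' (x y : ZMod 2) : z2Sign (x + y) = z2Sign x * z2Sign y := by
  revert x y; decide

/-- `χ(x) = 1` or `−1`; `χ(x) = −1 ↔ x ≠ 0`. [folklore] -/
private theorem z2Sign_eq_neg_one {x : ZMod 2} (h : x ≠ 0) : z2Sign x = -1 := by
  unfold z2Sign; simp [h]

open scoped Classical in
/-- **Character sum of an additive `𝔽₂`-valued function over a subspace**: if `φ` is additive on `H ≤ Ē` then
`Σ_{w ∈ H} (−1)^{φ(w)}` is `|H|` when `φ` vanishes on `H` and `0` otherwise (translation by a `w₀` with `φ(w₀) = 1`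
flips every sign). [cite: MacWilliamsSloane1977, Ch. 5 §2 Lemma 2 / Ch. 15 §2 (character sums over GF(2))] -/
theorem sum_z2Sign_additive (H : Submodule (ZMod 2) (SympVec n)) (φ : SympVec n → ZMod 2)
    (hφ : ∀ v ∈ H, ∀ w ∈ H, φ (v + w) = φ v + φ w) :
    ∑ w ∈ codeWords H, z2Sign (φ w) = if ∀ w ∈ H, φ w = 0 then (#(codeWords H) : ℤ) else 0 := by
  split_ifs with hall
  · rw [Finset.sum_congr rfl fun w hw => by rw [hall w (mem_codeWords.1 hw)]]
    simp [z2Sign]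
  · push Not at hall
    obtain ⟨w₀, hw₀, hne⟩ := hall
    have hshift : ∑ w ∈ codeWords H, z2Sign (φ (w + w₀)) = ∑ w ∈ codeWords H, z2Sign (φ w) := by
      refine Finset.sum_equiv (Equiv.addRight w₀) (fun w => ?_) (fun w _ => rfl)
      simp only [mem_codeWords, Equiv.coe_addRight]
      constructor
      · intro hw; exact H.add_mem hw hw₀
      · intro hw; simpa using H.sub_mem hw hw₀
    have hflip : ∑ w ∈ codeWords H, z2Sign (φ (w + w₀)) = -∑ w ∈ codeWords H, z2Sign (φ w) := by
      rw [← Finset.sum_neg_distrib]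
      refine Finset.sum_congr rfl fun w hw => ?_
      rw [hφ w (mem_codeWords.1 hw) w₀ hw₀, z2Sign_add', z2Sign_eq_neg_one hne]; ring
    have : (2 : ℤ) * ∑ w ∈ codeWords H, z2Sign (φ w) = 0 := by linarith [hshift.symm.trans hflip]
    linarith

/-! ### 4. The radical and the quadratic parity count -/

/-- **The radical** of `(·,·)_T` inside `C`: `{w ∈ C : (v,w)_T = 0 for all v ∈ C}` — a subspace.
[cite: MacWilliamsSloane1977, Ch. 15 §2 (radical of the associated bilinear form)] -/
def offRad (S : Submodule (ZMod 2) (SympVec n)) (u₀ : SympVec n) : Submodule (ZMod 2) (SympVec n) where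
  carrier := {w | w ∈ S ∧ ∀ v ∈ S, sympInnerOff u₀ v w = 0}
  add_mem' := by
    rintro w w' ⟨hw, hw0⟩ ⟨hw', hw0'⟩
    refine ⟨S.add_mem hw hw', fun v hv => ?_⟩
    rw [sympInnerOff_add_right, hw0 v hv, hw0' v hv, add_zero]
  zero_mem' := by
    refine ⟨S.zero_mem, fun v _ => ?_⟩
    unfold sympInnerOff locInner
    simp [letters]
  smul_mem' := by
    rintro c w ⟨hw, hw0⟩
    rcases (by decide : ∀ t : ZMod 2, t = 0 ∨ t = 1) c with rfl | rfl
    · rw [zero_smul]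
      refine ⟨S.zero_mem, fun v _ => ?_⟩
      unfold sympInnerOff locInner
      simp [letters]
    · rw [one_smul]; exact ⟨hw, hw0⟩

/-- Membership in the radical. [cite: MacWilliamsSloane1977, Ch. 15 §2] -/
theorem mem_offRad_iff {S : Submodule (ZMod 2) (SympVec n)} {u₀ w : SympVec n} :
    w ∈ offRad S u₀ ↔ w ∈ S ∧ ∀ v ∈ S, sympInnerOff u₀ v w = 0 := Iff.rfl

open scoped Classical in
/-- The character sum `s = Σ_{v ∈ C} (−1)^{a(v)}` equals `2Z − |C|`, `Z` the number of `v ∈ C` with `a(v)` even.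
[cite: MacWilliamsSloane1977, Ch. 15 §2] -/
theorem sum_z2Sign_offWt_eq (S : Submodule (ZMod 2) (SympVec n)) (u₀ : SympVec n) :
    ∑ v ∈ codeWords S, z2Sign ((offWt u₀ v : ℕ) : ZMod 2) =
      2 * (#((codeWords S).filter fun v => Even (offWt u₀ v)) : ℤ) - #(codeWords S) := by
  have hsplit := Finset.sum_filter_add_sum_filter_not (codeWords S) (fun v => Even (offWt u₀ v))
    (fun v => z2Sign ((offWt u₀ v : ℕ) : ZMod 2))
  have h1 : ∑ v ∈ (codeWords S).filter (fun v => Even (offWt u₀ v)), z2Sign ((offWt u₀ v : ℕ) : ZMod 2) =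
      (#((codeWords S).filter fun v => Even (offWt u₀ v)) : ℤ) := by
    rw [Finset.sum_congr rfl fun v hv => by
      rw [(ZMod.natCast_eq_zero_iff_even.2 (mem_filter.1 hv).2 : ((offWt u₀ v : ℕ) : ZMod 2) = 0)]]
    simp [z2Sign]
  have h2 : ∑ v ∈ (codeWords S).filter (fun v => ¬ Even (offWt u₀ v)), z2Sign ((offWt u₀ v : ℕ) : ZMod 2) =
      -(#((codeWords S).filter fun v => ¬ Even (offWt u₀ v)) : ℤ) := by
    rw [Finset.sum_congr rfl fun v hv => by
      rw [z2Sign_eq_neg_one (fun h => (mem_filter.1 hv).2 (ZMod.natCast_eq_zero_iff_even.1 h))]]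
    simp
  have hcard := Finset.card_filter_add_card_filter_not (s := codeWords S) (fun v => Even (offWt u₀ v))
  rw [← hsplit, h1, h2]
  have : ((#((codeWords S).filter fun v => Even (offWt u₀ v)) : ℕ) : ℤ) +
      (#((codeWords S).filter fun v => ¬ Even (offWt u₀ v)) : ℤ) = #(codeWords S) := by exact_mod_cast hcard
  linarith

open scoped Classical in
/-- **The square of the character sum**: `s² = |C| · Σ_{w ∈ rad} (−1)^{a(w)}` (expand, reindex `w ↦ v + w`, use
`a(v) + a(v+w) ≡ a(w) + (v,w)_T`, and sum the character `(−1)^{(v,w)_T}` over `v ∈ C`).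
[cite: MacWilliamsSloane1977, Ch. 15 §2, proof of Thm. 4] -/
theorem sum_z2Sign_offWt_sq (S : Submodule (ZMod 2) (SympVec n)) (u₀ : SympVec n) :
    (∑ v ∈ codeWords S, z2Sign ((offWt u₀ v : ℕ) : ZMod 2)) ^ 2 =
      (#(codeWords S) : ℤ) * ∑ w ∈ codeWords (offRad S u₀), z2Sign ((offWt u₀ w : ℕ) : ZMod 2) := by
  set χ : SympVec n → ℤ := fun v => z2Sign ((offWt u₀ v : ℕ) : ZMod 2) with hχ
  -- expand the square and reindex the inner sum by translation
  have hsq : (∑ v ∈ codeWords S, χ v) ^ 2 = ∑ v ∈ codeWords S, ∑ w ∈ codeWords S, χ v * χ (v + w) := by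
    rw [sq, Finset.sum_mul_sum]
    refine Finset.sum_congr rfl fun v hv => ?_
    have hvS := mem_codeWords.1 hv
    refine (Finset.sum_equiv (Equiv.addLeft v) (fun w => ?_) (fun w _ => rfl)).symm
    simp only [mem_codeWords, Equiv.coe_addLeft]
    constructor
    · intro hw; exact S.add_mem hvS hw
    · intro hw; simpa using S.sub_mem hw hvS
  -- `χ v · χ (v + w) = χ w · (−1)^{(v,w)_T}`
  have hprod : ∀ v w, χ v * χ (v + w) = χ w * z2Sign (sympInnerOff u₀ v w) := by
    intro v w
    simp only [hχ]
    rw [← z2Sign_add', ← z2Sign_add', natCast_offWt_add]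
    congr 1
    have h2 : ((offWt u₀ v : ℕ) : ZMod 2) + (offWt u₀ v : ZMod 2) = 0 := CharTwo.add_self_eq_zero _
    linear_combination h2
  simp_rw [hsq, hprod]
  rw [Finset.sum_comm]
  simp_rw [← Finset.mul_sum]
  -- the character sum over `v`
  have hchar : ∀ w ∈ codeWords S, ∑ v ∈ codeWords S, z2Sign (sympInnerOff u₀ v w) =
      if w ∈ offRad S u₀ then (#(codeWords S) : ℤ) else 0 := by
    intro w hw
    rw [sum_z2Sign_additive S (fun v => sympInnerOff u₀ v w)
      (fun v _ v' _ => sympInnerOff_add_left u₀ v v' w)]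
    have : (∀ v ∈ S, sympInnerOff u₀ v w = 0) ↔ w ∈ offRad S u₀ := by
      rw [mem_offRad_iff]; exact ⟨fun h => ⟨mem_codeWords.1 hw, h⟩, fun h => h.2⟩
    simp only [this]
  rw [Finset.sum_congr rfl fun w hw => by rw [hchar w hw], Finset.mul_sum]
  rw [← Finset.sum_filter_add_sum_filter_not (codeWords S) (· ∈ offRad S u₀)]
  have hA : ∑ w ∈ (codeWords S).filter (· ∈ offRad S u₀),
      χ w * (if w ∈ offRad S u₀ then (#(codeWords S) : ℤ) else 0) =
      ∑ w ∈ codeWords (offRad S u₀), (#(codeWords S) : ℤ) * χ w := by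
    refine Finset.sum_congr ?_ fun w hw => ?_
    · ext w; simp only [mem_filter, mem_codeWords, mem_offRad_iff]; tauto
    · rw [if_pos (mem_filter.1 hw).2, mul_comm]
  have hB : ∑ w ∈ (codeWords S).filter (fun w => ¬ w ∈ offRad S u₀),
      χ w * (if w ∈ offRad S u₀ then (#(codeWords S) : ℤ) else 0) = 0 :=
    Finset.sum_eq_zero fun w hw => by rw [if_neg (mem_filter.1 hw).2, mul_zero]
  rw [hA, hB, add_zero]

open scoped Classical in
/-- On the radical the parity of `a` is ADDITIVE, so `Σ_{w ∈ rad} (−1)^{a(w)} ∈ {|rad|, 0}`.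
[cite: MacWilliamsSloane1977, Ch. 15 §2] -/
theorem sum_z2Sign_offWt_rad (S : Submodule (ZMod 2) (SympVec n)) (u₀ : SympVec n) :
    ∑ w ∈ codeWords (offRad S u₀), z2Sign ((offWt u₀ w : ℕ) : ZMod 2) = #(codeWords (offRad S u₀)) ∨
    ∑ w ∈ codeWords (offRad S u₀), z2Sign ((offWt u₀ w : ℕ) : ZMod 2) = 0 := by
  have h := sum_z2Sign_additive (offRad S u₀) (fun w => ((offWt u₀ w : ℕ) : ZMod 2)) (fun v hv w hw => by
    rw [natCast_offWt_add, (mem_offRad_iff.1 hw).2 v (mem_offRad_iff.1 hv).1, add_zero])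
  rw [h]
  split_ifs
  · left; rfl
  · right; rfl

open scoped Classical in
/-- **Quadratic parity count (the zero count of a quadratic form over `GF(2)`).** For every subspace `C = S̄` of `Ē`
and every `u₀`, the number `Z = #{v ∈ C : a(v) even}` of codewords with an even number of nonzero letters off
`supp u₀` satisfies `(2Z − |C|)² = 0` or `(2Z − |C|)² = 2^j` for some `j` (namely `|C|·|rad|`): `Z` is `|C|/2` or
`|C|/2 ± 2^i`. Column: PROVED. [cite: MacWilliamsSloane1977, Ch. 15 §2 Thm. 5 (number of zeros of a quadratic form)] -/
theorem offWt_parity_count (S : Submodule (ZMod 2) (SympVec n)) (u₀ : SympVec n) :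
    (2 * (#((codeWords S).filter fun v => Even (offWt u₀ v)) : ℤ) - #(codeWords S)) ^ 2 = 0 ∨
    ∃ j : ℕ, (2 * (#((codeWords S).filter fun v => Even (offWt u₀ v)) : ℤ) - #(codeWords S)) ^ 2 = 2 ^ j := by
  rw [← sum_z2Sign_offWt_eq, sum_z2Sign_offWt_sq]
  rcases sum_z2Sign_offWt_rad S u₀ with h | h
  · right
    rw [h, card_codeWords S, card_codeWords (offRad S u₀)]
    exact ⟨Module.finrank (ZMod 2) S + Module.finrank (ZMod 2) ↥(offRad S u₀), by push_cast; ring⟩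
  · left; rw [h, mul_zero]

end Summit.Ventures.QEC.Census
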